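import Summits.Ventures.YMGap.RobustBall.FiniteHeatBathKernel
import HarnessLib

/-!
# RobustBall/FiniteGibbsInfluence — one-site total-variation influences of an exponential-sum weight
# `w = exp(β ∑_p φ_p)` with local, bounded terms: `tv ≤ |β| · A · #{p ∋ x, y}`

HONEST FRAMING: elementary finite combinatorics (finite sums only, no measure theory), written for the
centre-projection area law of track Y2 (cell `pub-ymgap`, seat ds-4 g7): the Dobrushin influence
coefficients of a finite spin system whose weight is the exponential of a sum of LOCAL terms (each reading a
finite set of spins and bounded by `A`) — the shape of every lattice gauge / plaquette weight.  Nothing is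
specific to gauge theories; nothing is claimed about any continuum limit.

* `tv_le_quarter_of_osc` — the sharp tilt bound in oscillation form: if the conditional weights at `x` in
  two environments differ by `e^{h(s)}` with `h s − h s' ≤ D`, then `tv ≤ D/4` (Ising-exact `tanh(D/4) ≤ D/4`).
* `tv_le_of_exp_sum` — for `w σ = exp(β ∑_p φ_p σ)`, `φ_p` reading only `links p`, `|φ_p| ≤ A`:
  changing the spin at `y ≠ x` moves the one-site law at `x` by at most
  `|β| · A · #{p : x ∈ links p ∧ y ∈ links p}` in total variation (only terms through BOTH sites matter,
  each contributes oscillation `≤ 4A`).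

References: Georgii 2011 Prop. 8.8; Friedli–Velenik 2017 §6.5.2; Simon 1993 §V.1 (Dobrushin coefficients
of finite-range interactions).
-/

noncomputable section

open Finset Function Real

namespace Summit.Ventures.YMGap.RobustBall.FiniteGibbs

variable {V S : Type*} [DecidableEq V] [Fintype S] [Nonempty S]

/-- **Sharp tilt bound, oscillation form**: `w(τ^{x,s}) = w(σ^{x,s}) e^{h(s)}` with `h s − h s' ≤ D` for all
`s, s'` gives `tv w x σ τ ≤ D/4`. [folklore] -/
theorem tv_le_quarter_of_osc {w : (V → S) → ℝ} (hw : ∀ σ, 0 < w σ) (x : V) (σ τ : V → S)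
    {h : S → ℝ} {D : ℝ} (hD : ∀ s s', h s - h s' ≤ D)
    (hwh : ∀ s, w (update τ x s) = w (update σ x s) * Real.exp (h s)) : tv w x σ τ ≤ D / 4 := by
  have hD0 : 0 ≤ D := by simpa using hD (Classical.arbitrary S) (Classical.arbitrary S)
  have ha : 1 ≤ Real.exp (D / 2) := Real.one_le_exp (by linarith)
  have hrr : ∀ s s', Real.exp (h s) ≤ Real.exp (D / 2) ^ 2 * Real.exp (h s') := by
    intro s s'
    rw [← Real.exp_nat_mul, ← Real.exp_add, Real.exp_le_exp]
    have := hD s s'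
    push_cast; linarith
  have hmain := posSum_le_of_ratio (u := fun s => w (update σ x s)) (r := fun s => Real.exp (h s))
    (fun s => hw _) (fun s => Real.exp_pos _) ha hrr
  have hq : ∀ s, w (update σ x s) * Real.exp (h s) / ∑ s', w (update σ x s') * Real.exp (h s') =
      hbProb w x τ s := fun s => by simp only [hbProb, siteZ, hwh]
  have hp : ∀ s, w (update σ x s) / ∑ s', w (update σ x s') = hbProb w x σ s := fun s => rfl
  simp only [hq, hp] at hmain
  have hsym : tv w x σ τ = ∑ s, (hbProb w x τ s - hbProb w x σ s)⁺ := by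
    rw [tv]
    have h0 : ∑ s, ((hbProb w x σ s - hbProb w x τ s)⁺ - (hbProb w x σ s - hbProb w x τ s)⁻) = 0 := by
      simp only [posPart_sub_negPart, Finset.sum_sub_distrib, sum_hbProb hw, sub_self]
    rw [Finset.sum_sub_distrib, sub_eq_zero] at h0
    rw [h0]
    exact Finset.sum_congr rfl fun s _ => by rw [negPart_def, neg_sub, posPart_def]
  rw [hsym]
  calc ∑ s, (hbProb w x τ s - hbProb w x σ s)⁺ ≤ (Real.exp (D / 2) - 1) / (Real.exp (D / 2) + 1) := hmain
    _ ≤ D / 2 / 2 := exp_sub_one_div_le_half (by linarith)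
    _ = D / 4 := by ring

/-- **One-site influences of an exponential-sum weight with local bounded terms.**  Let
`w σ = exp(β ∑_p φ_p σ)` where each `φ_p` reads only the spins in `links p` and `|φ_p| ≤ A`.  If `σ, τ`
agree off `y`, the one-site laws at `x` satisfy
`tv w x σ τ ≤ |β| · A · #{p : x ∈ links p ∧ y ∈ links p}`. [cite: Georgii2011, Prop. 8.8] -/
theorem tv_le_of_exp_sum {P : Type*} [Fintype P] (links : P → Finset V) (φ : P → (V → S) → ℝ)
    (hdep : ∀ p, DependsOn (φ p) (↑(links p) : Set V)) {A : ℝ} (hA : ∀ p σ, |φ p σ| ≤ A) (β : ℝ)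
    {w : (V → S) → ℝ} (hw : ∀ σ, w σ = Real.exp (β * ∑ p, φ p σ)) {x y : V}
    {σ τ : V → S} (hστ : ∀ z, z ≠ y → σ z = τ z) [DecidablePred fun p => x ∈ links p ∧ y ∈ links p] :
    tv w x σ τ ≤ |β| * A * ((Finset.univ.filter fun p => x ∈ links p ∧ y ∈ links p).card : ℝ) := by
  have hwpos : ∀ σ, 0 < w σ := fun σ => by rw [hw]; exact Real.exp_pos _
  set Q := Finset.univ.filter fun p => x ∈ links p ∧ y ∈ links p with hQ
  -- the log-ratio of the two conditional weights
  set h : S → ℝ := fun s => β * ∑ p, (φ p (update τ x s) - φ p (update σ x s)) with hh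
  have hwh : ∀ s, w (update τ x s) = w (update σ x s) * Real.exp (h s) := fun s => by
    rw [hw, hw, ← Real.exp_add]
    congr 1
    rw [hh]; dsimp only
    rw [Finset.sum_sub_distrib]; ring
  -- terms through both sites: oscillation ≤ 4A; other terms: constant in `s`
  have hterm : ∀ (p : P) (s s' : S),
      (φ p (update τ x s) - φ p (update σ x s)) - (φ p (update τ x s') - φ p (update σ x s')) ≤
        if x ∈ links p ∧ y ∈ links p then 4 * A else 0 := by
    intro p s s'
    split_ifs with hp
    · have h1 := abs_le.1 (hA p (update τ x s))
      have h2 := abs_le.1 (hA p (update σ x s))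
      have h3 := abs_le.1 (hA p (update τ x s'))
      have h4 := abs_le.1 (hA p (update σ x s'))
      linarith [h1.1, h1.2, h2.1, h2.2, h3.1, h3.2, h4.1, h4.2]
    · rw [not_and_or] at hp
      rcases hp with hx | hy
      · -- `x ∉ links p`: both updates are invisible to `φ p`
        have hzx : ∀ z ∈ (↑(links p) : Set V), z ≠ x := fun z hz h => hx (h ▸ Finset.mem_coe.1 hz)
        have eτ : φ p (update τ x s) = φ p (update τ x s') :=
          hdep p fun z hz => by rw [update_of_ne (hzx z hz), update_of_ne (hzx z hz)]
        have eσ : φ p (update σ x s) = φ p (update σ x s') :=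
          hdep p fun z hz => by rw [update_of_ne (hzx z hz), update_of_ne (hzx z hz)]
        rw [eτ, eσ]; simp
      · -- `y ∉ links p`: `σ` and `τ` agree on `links p`
        have e1 : φ p (update τ x s) = φ p (update σ x s) :=
          hdep p fun z hz => (update_agree_of_agree hστ s z (fun h => hy (h ▸ Finset.mem_coe.1 hz))).symm
        have e2 : φ p (update τ x s') = φ p (update σ x s') :=
          hdep p fun z hz => (update_agree_of_agree hστ s' z (fun h => hy (h ▸ Finset.mem_coe.1 hz))).symm
        rw [e1, e2]; simp
  have hD : ∀ s s', h s - h s' ≤ 4 * |β| * A * (Q.card : ℝ) := by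
    intro s s'
    have hsum : ∑ p, ((φ p (update τ x s) - φ p (update σ x s)) - (φ p (update τ x s') - φ p (update σ x s')))
        ≤ ∑ p, (if x ∈ links p ∧ y ∈ links p then 4 * A else 0) :=
      Finset.sum_le_sum fun p _ => hterm p s s'
    rw [Finset.sum_ite, Finset.sum_const_zero, add_zero, Finset.sum_const, nsmul_eq_mul, ← hQ] at hsum
    have hsum' : |∑ p, ((φ p (update τ x s) - φ p (update σ x s)) -
        (φ p (update τ x s') - φ p (update σ x s')))| ≤ (Q.card : ℝ) * (4 * A) := by
      rw [abs_le]
      refine ⟨?_, hsum⟩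
      have hsum2 : ∑ p, ((φ p (update τ x s') - φ p (update σ x s')) -
          (φ p (update τ x s) - φ p (update σ x s))) ≤ ∑ p, (if x ∈ links p ∧ y ∈ links p then 4 * A else 0) :=
        Finset.sum_le_sum fun p _ => hterm p s' s
      rw [Finset.sum_ite, Finset.sum_const_zero, add_zero, Finset.sum_const, nsmul_eq_mul, ← hQ] at hsum2
      have : ∑ p, ((φ p (update τ x s') - φ p (update σ x s')) - (φ p (update τ x s) - φ p (update σ x s))) =
          -∑ p, ((φ p (update τ x s) - φ p (update σ x s)) - (φ p (update τ x s') - φ p (update σ x s'))) := by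
        rw [← Finset.sum_neg_distrib]; exact Finset.sum_congr rfl fun p _ => by ring
      linarith
    have hhs : h s - h s' = β * ∑ p, ((φ p (update τ x s) - φ p (update σ x s)) -
        (φ p (update τ x s') - φ p (update σ x s'))) := by
      rw [hh]; dsimp only; rw [← mul_sub, ← Finset.sum_sub_distrib]
    rw [hhs]
    calc β * _ ≤ |β * ∑ p, ((φ p (update τ x s) - φ p (update σ x s)) -
          (φ p (update τ x s') - φ p (update σ x s')))| := le_abs_self _
      _ = |β| * |∑ p, ((φ p (update τ x s) - φ p (update σ x s)) -
          (φ p (update τ x s') - φ p (update σ x s')))| := abs_mul _ _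
      _ ≤ |β| * ((Q.card : ℝ) * (4 * A)) := mul_le_mul_of_nonneg_left hsum' (abs_nonneg _)
      _ = 4 * |β| * A * (Q.card : ℝ) := by ring
  calc tv w x σ τ ≤ 4 * |β| * A * (Q.card : ℝ) / 4 := tv_le_quarter_of_osc hwpos x σ τ hD hwh
    _ = |β| * A * (Q.card : ℝ) := by ring

end Summit.Ventures.YMGap.RobustBall.FiniteGibbs

end
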